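import Summits.Ventures.MM22.Rank333.ProfileCertL494Store0
import Summits.Ventures.MM22.Rank333.ProfileCertL494Store1
import Summits.Ventures.MM22.Rank333.ProfileCertL494Store2
import Summits.Ventures.MM22.Rank333.ProfileCertL494Store3
import HarnessLib

/-!
# MM22 venture — PROFILE-CERT kernel replay DATA (sub-instance 494): row store (composition of the 4 parts)

HONEST FRAMING (cell `pub-mm22`, seat bench g6; V4-MENU item (0′), object «494 @ 20»). Generated by `pc2treeS.py` from p2 g4's
sub-instance certificate `lift494_at20_on_4dim2_evencomp.pcert` (sha256 b8ae5e67afcf…; «evencomp» convention; VALID under p2's and the referee's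
conventional checkers) — the 2-level composition by the low bits of the global row id. Every theorem here is a `decide +kernel` (or `rfl`/`decide`) about the checkers of
`ProfileCertKernel` (p1 g5); its MEANING is supplied by p1's `ProfileCertSub`/`ProfileCertSubSym`, LIT-2's `GF2ProfileRowsSub`/`GF2ProfileSymmetrySub` and the assembly files. Nothing here
is a bound on `R_𝔽₂(⟨3,3,3⟩)`; no summit claim.
-/

set_option autoImplicit false
set_option maxRecDepth 200000
set_option maxHeartbeats 0

namespace Summit.Ventures.MM22.ProfileCert.L494

open Summit.MatrixMultiplication.OmegaCensus.GF2RankLB Summit.Ventures.MM22.ProfileCert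

/-- The row store of the sub-instance certificate (1678 rows): `pcRT.get i = pcStore(i % 4).get (i / 4)`. -/
def pcRT : RT := (RT.node (RT.node pcStore0 pcStore2) (RT.node pcStore1 pcStore3))

end Summit.Ventures.MM22.ProfileCert.L494
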